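import Literature.Probability.RandomPlanarGeometry.SAWPulledLargeForceExpansionZdCostPolynomial
import Literature.Probability.RandomPlanarGeometry.SAWIrreducibleBridgeSpanOne
import Mathlib.Algebra.Group.ForwardDiff
import HarnessLib

/-!
# ABSOLUTE MONOTONICITY IN THE DIMENSION: every finite difference of `d ↦ N_{c,n}(ℤ^{d+1})` and of `d ↦ c_n(ℤ^d)` is non-negative —
# in particular `c_n(ℤ^d)` is non-decreasing and CONVEX in `d`

Topic `Literature/Probability/RandomPlanarGeometry` (uses `SAWPulledLargeForceExpansionZdCostPolynomial.costCoeffZd_eq_sum_choose_mul` (a-p1: `N_{c,n}(ℤ^{d+1}) = Σ_u C(d,u) F_{c,n}(u)`,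
`F ≥ 0`), `SAWIrreducibleBridgeSpanOne.costCoeffZd_self_succ` (`c_n(ℤ^d) = N_{n,n+1}(ℤ^{d+1})`), and Mathlib's forward differences `fwdDiff`, `fwdDiff_iter_choose`).

PRINTED CONTEXT (locators only). Madras–Slade (1993) §1.1 eq. (1.1.8) p. 5 (counts in general `d`); Clisby–Liang–Slade (2007) §3.3 eqs. (29)/(31) (decomposition by the number of
dimensions explored, non-negative class counts). NOT IN PRINT (lane statement): a non-negative combination of the binomial polynomials `C(d,u)` has ALL its forward
differences non-negative (`Δ^k C(·,u) = C(·,u−k)` or `0`), so: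

* ★★★ `fwdDiff_iter_costCoeffZd_nonneg` — **`Δ^k_d N_{c,n}(ℤ^{d+1}) ≥ 0`** for all `c, n, k, d`; ★★★ `fwdDiff_iter_count_nonneg` — **`Δ^k_d c_n(ℤ^d) ≥ 0`** for all `n, k, d`;
* ★★ `count_le_count_dim_succ` (**`c_n(ℤ^d) ≤ c_n(ℤ^{d+1})`**), ★★ `two_mul_count_le_add` (**`2c_n(ℤ^{d+1}) ≤ c_n(ℤ^d) + c_n(ℤ^{d+2})`: convexity in the dimension**),
  ★★ `costCoeffZd_le_and_convex` (the same for every cost cell). (The generic census of `SAWZdLateralClassCensus` gives the same for bridges, half-space walks, bridges by span.)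
[cite: MadrasSlade1993, §1.1 eq. (1.1.8) p. 5; §4.2 eq. (4.2.20)–(4.2.22) p. 94] [cite: ClisbyLiangSlade2007, §3.3 eqs. (29)/(31)]

Provenance: lane «pcv-sawmu», a-p3 g25 (2026-08-28). PURE STD, no data, no definitions.
-/

noncomputable section

open Finset
open scoped BigOperators
open Literature.Probability.LatticeModels
open Literature.Probability.RandomPlanarGeometry.SAW

namespace Literature.Probability.RandomPlanarGeometry.SAW.Zd

/-! ## §15 Absolute monotonicity in the dimension: every finite difference of `d ↦ N_{c,n}(ℤ^{d+1})`, `d ↦ c_n(ℤ^d)` is `≥ 0` -/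

section AbsMono

/-- Iterated forward differences of the zero function vanish. [folklore] -/
private theorem fwdDiff_iter_zero_fun (m : ℕ) : (fwdDiff (1 : ℕ))^[m] (fun _ : ℕ => (0 : ℤ)) = fun _ => 0 := by
  induction m with
  | zero => rfl
  | succ m ih => rw [Function.iterate_succ_apply, fwdDiff_const, ih]

/-- `Δ^k C(·, v) = C(·, v − k)` for `k ≤ v` and `0` for `v < k`; in either case its values are `≥ 0`. [folklore] -/
private theorem fwdDiff_iter_choose_apply_nonneg (v k d : ℕ) : 0 ≤ (fwdDiff (1 : ℕ))^[k] (fun x : ℕ => (x.choose v : ℤ)) d := by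
  rcases le_or_gt k v with hkv | hvk
  · obtain ⟨j, rfl⟩ := Nat.exists_eq_add_of_le hkv
    rw [fwdDiff_iter_choose]
    exact Int.natCast_nonneg _
  · obtain ⟨m, rfl⟩ := Nat.exists_eq_add_of_lt hvk
    -- `Δ^{v+m+1} C(·,v) = Δ^{m} (Δ (Δ^{v} C(·,v))) = Δ^m (Δ 1) = 0`
    have h1 : (fwdDiff (1 : ℕ))^[v] (fun x : ℕ => (x.choose v : ℤ)) = fun x : ℕ => (x.choose 0 : ℤ) := by
      have := fwdDiff_iter_choose 0 v
      simpa only [add_zero] using this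
    rw [show v + m + 1 = (m + 1) + v by ring, Function.iterate_add_apply, h1]
    simp only [Nat.choose_zero_right, Nat.cast_one]
    rw [Function.iterate_succ_apply, fwdDiff_const, fwdDiff_iter_zero_fun]

/-- Finite differences of a NON-NEGATIVE binomial-basis combination are non-negative at every point. [folklore] -/
private theorem fwdDiff_iter_sum_mul_choose_nonneg (s : Finset ℕ) (F : ℕ → ℤ) (hF : ∀ v ∈ s, 0 ≤ F v) (k d : ℕ) :
    0 ≤ (fwdDiff (1 : ℕ))^[k] (fun e : ℕ => ∑ v ∈ s, F v * (e.choose v : ℤ)) d := by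
  have hfun : (fun e : ℕ => ∑ v ∈ s, F v * (e.choose v : ℤ)) = ∑ v ∈ s, F v • (fun e : ℕ => (e.choose v : ℤ)) := by
    ext e
    simp [Finset.sum_apply]
  rw [hfun, ← fwdDiff_aux.coe_fwdDiffₗ_pow, map_sum, Finset.sum_apply]
  refine Finset.sum_nonneg fun v hv => ?_
  rw [map_zsmul, Pi.smul_apply, fwdDiff_aux.coe_fwdDiffₗ_pow, smul_eq_mul]
  exact mul_nonneg (hF v hv) (fwdDiff_iter_choose_apply_nonneg v k d)

/-- ★★★ **ABSOLUTE MONOTONICITY OF THE COST CENSUS IN THE DIMENSION**: for all `c, n, k, d`, `Δ^k_d N_{c,n}(ℤ^{d+1}) ≥ 0` — the census is a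
NON-NEGATIVE combination of the binomial polynomials `C(d,u)` (`costCoeffZd_eq_sum_choose_mul`), whose differences are binomial polynomials again.
[cite: MadrasSlade1993, §1.1 eq. (1.1.8) p. 5; §4.2 eq. (4.2.20)–(4.2.22) p. 94] -/
theorem fwdDiff_iter_costCoeffZd_nonneg (c n k d : ℕ) :
    0 ≤ (fwdDiff (1 : ℕ))^[k] (fun e : ℕ => (costCoeffZd e c n : ℤ)) d := by
  have h : (fun e : ℕ => (costCoeffZd e c n : ℤ)) = fun e : ℕ => ∑ v ∈ Finset.range (c + 1),
      (((irreducibleBridges (v + 1) n).filter fun (ω : ℕ → Site (v + 1)) => costZd v n ω = c ∧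
        ∀ a : Fin (v + 1), a ≠ 0 → ∃ i ≤ n, ω i a ≠ (0 : ℤ)).card : ℤ) * (e.choose v : ℤ) := by
    ext e
    rw [costCoeffZd_eq_sum_choose_mul]
    push_cast
    exact Finset.sum_congr rfl fun v _ => mul_comm _ _
  rw [h]
  exact fwdDiff_iter_sum_mul_choose_nonneg _ _ (fun v _ => by positivity) k d

/-- ★★★ **ABSOLUTE MONOTONICITY OF `c_n(ℤ^d)` IN THE DIMENSION**: for all `n, k, d`, `Δ^k_d c_n(ℤ^d) ≥ 0` — in particular `d ↦ c_n(ℤ^d)` is non-decreasing and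
CONVEX. [cite: MadrasSlade1993, §1.1 eq. (1.1.8) p. 5] [cite: ClisbyLiangSlade2007, §3.3 eqs. (29)/(31)] -/
theorem fwdDiff_iter_count_nonneg (n k d : ℕ) :
    0 ≤ (fwdDiff (1 : ℕ))^[k] (fun e : ℕ => (count e n : ℤ)) d := by
  have h := fwdDiff_iter_costCoeffZd_nonneg n (n + 1) k d
  simpa only [costCoeffZd_self_succ] using h

/-- ★★ `c_n(ℤ^d) ≤ c_n(ℤ^{d+1})` for every `n`, `d` (`k = 1`). [cite: MadrasSlade1993, §1.1 eq. (1.1.8) p. 5] -/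
theorem count_le_count_dim_succ (n d : ℕ) : count d n ≤ count (d + 1) n := by
  have h := fwdDiff_iter_count_nonneg n 1 d
  simp only [Function.iterate_one, fwdDiff] at h
  exact_mod_cast (sub_nonneg.1 h)

/-- ★★ **CONVEXITY IN THE DIMENSION**: `2·c_n(ℤ^{d+1}) ≤ c_n(ℤ^d) + c_n(ℤ^{d+2})` for every `n`, `d` (`k = 2`).
[cite: MadrasSlade1993, §1.1 eq. (1.1.8) p. 5] -/
theorem two_mul_count_le_add (n d : ℕ) : 2 * count (d + 1) n ≤ count d n + count (d + 2) n := by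
  have h := fwdDiff_iter_count_nonneg n 2 d
  simp only [Function.iterate_succ, Function.iterate_zero, Function.comp_apply, id_eq, fwdDiff] at h
  have : (2 * count (d + 1) n : ℤ) ≤ count d n + count (d + 2) n := by linarith
  exact_mod_cast this

/-- ★★ `N_{c,n}(ℤ^{d+1}) ≤ N_{c,n}(ℤ^{d+2})` and `2·N_{c,n}(ℤ^{d+2}) ≤ N_{c,n}(ℤ^{d+1}) + N_{c,n}(ℤ^{d+3})`: the cost census is non-decreasing and convex in the
dimension. [cite: MadrasSlade1993, §4.2 eq. (4.2.20)–(4.2.22) p. 94] -/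
theorem costCoeffZd_le_and_convex (c n d : ℕ) :
    costCoeffZd d c n ≤ costCoeffZd (d + 1) c n ∧ 2 * costCoeffZd (d + 1) c n ≤ costCoeffZd d c n + costCoeffZd (d + 2) c n := by
  have h1 := fwdDiff_iter_costCoeffZd_nonneg c n 1 d
  have h2 := fwdDiff_iter_costCoeffZd_nonneg c n 2 d
  simp only [Function.iterate_one, fwdDiff] at h1
  simp only [Function.iterate_succ, Function.iterate_zero, Function.comp_apply, id_eq, fwdDiff] at h2
  refine ⟨by exact_mod_cast (sub_nonneg.1 h1), ?_⟩
  have : (2 * costCoeffZd (d + 1) c n : ℤ) ≤ costCoeffZd d c n + costCoeffZd (d + 2) c n := by linarith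
  exact_mod_cast this

end AbsMono

end Literature.Probability.RandomPlanarGeometry.SAW.Zd

end
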